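import Summits.AtomisticToContinuum.Crystallization.Theorems.OverbindingBudgetElasticSplitShear

/-!
# The uniaxial virial as a symmetric form; dictionary to `shearGain` / `StressFree` (slot 7b seed, part B — decomp-a2c lens-3)

`…ElasticSplitShear.shearGain u F = min (3 (D₁₂ᵘ − D₆ᵘ)² / (392 D₁₂ᵘ)) (|D₁₂ᵘ − D₆ᵘ| / 80)`.  Here: the EXACT identity
`D₁₂ᵘ(F) − D₆ᵘ(F) = 𝒲(F)(u, u)` with the SYMMETRIC BILINEAR pair form
`𝒲(F)(u, v) = Σ_{i} Σ_{k ≠ i} (r_ik⁻¹⁴ − r_ik⁻⁸) ⟪u, y_k − y_i⟫ ⟪v, y_k − y_i⟫` (the LJ pair force is `(r⁻¹⁴ − r⁻⁸)·Δ`), its polarisation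
`𝒲(n+t, n+t) − 𝒲(n−t, n−t) = 4 𝒲(n, t)`, the monotone lower bound for `shearGain` from a lower bound on `|𝒲(u,u)|` and an upper bound on `D₁₂ᵘ`,
and the contradiction with `StressFree`: cofinal cubes with `|𝒲(F)(u,u)| ≥ c ℓ³` and `D₁₂ᵘ(F) ≤ C ℓ³` are `ShearStrainedCubes`.
-/

namespace Summit.AtomisticToContinuum.Crystallization.Theorems.ChartedPlanarOrderPlanesVirialForm

open scoped BigOperators
open Summit.AtomisticToContinuum.Crystallization.Theorems.OverbindingBudgetElasticSplitDilation (enum)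
open Summit.AtomisticToContinuum.Crystallization.Theorems.OverbindingBudgetElasticSplitShear (dirSum shearGain ShearStrainedCubes StressFree)

local notation "E3" => EuclideanSpace ℝ (Fin 3)

/-- The pair virial form of a chunk: `𝒲(F)(u, v) = Σ_i Σ_{k ≠ i} (r⁻¹⁴ − r⁻⁸) ⟪u, y_k − y_i⟫ ⟪v, y_k − y_i⟫` (ordered pairs, own enumeration). -/
noncomputable def virialForm (F : Finset E3) (u v : E3) : ℝ :=
  ∑ i ∈ (Finset.univ : Finset (Fin F.card)), ∑ k ∈ (Finset.univ : Finset (Fin F.card)).erase i,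
    ((dist (enum F i) (enum F k))⁻¹ ^ 14 - (dist (enum F i) (enum F k))⁻¹ ^ 8) *
      (inner ℝ u (enum F k - enum F i) * inner ℝ v (enum F k - enum F i))

/-- ★ dictionary: `D₁₂ᵘ − D₆ᵘ = 𝒲(u, u)` (termwise; no injectivity needed: both sides vanish on a zero distance). -/
theorem dirSum_sub_dirSum (u : E3) (F : Finset E3) : dirSum 12 u F - dirSum 6 u F = virialForm F u u := by
  unfold dirSum virialForm
  rw [← Finset.sum_sub_distrib]
  refine Finset.sum_congr rfl fun i _ => ?_
  rw [← Finset.sum_sub_distrib]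
  refine Finset.sum_congr rfl fun k _ => ?_
  set d := dist (enum F i) (enum F k)
  set p := inner ℝ u (enum F k - enum F i)
  rw [div_pow, ← sub_mul]
  by_cases hd : d = 0
  · simp [hd]
  · field_simp

/-- symmetry. -/
theorem virialForm_comm (F : Finset E3) (u v : E3) : virialForm F u v = virialForm F v u := by
  unfold virialForm
  refine Finset.sum_congr rfl fun i _ => Finset.sum_congr rfl fun k _ => ?_
  ring

/-- ★ polarisation: `𝒲(n+t, n+t) − 𝒲(n−t, n−t) = 4 𝒲(n, t)`. -/
theorem virialForm_polar (F : Finset E3) (n t : E3) :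
    virialForm F (n + t) (n + t) - virialForm F (n - t) (n - t) = 4 * virialForm F n t := by
  unfold virialForm
  rw [← Finset.sum_sub_distrib, Finset.mul_sum]
  refine Finset.sum_congr rfl fun i _ => ?_
  rw [← Finset.sum_sub_distrib, Finset.mul_sum]
  refine Finset.sum_congr rfl fun k _ => ?_
  rw [inner_add_left, inner_sub_left]
  ring


/-- `D₁₂ᵘ ≥ 0` termwise. -/
theorem dirSum_nonneg (n : ℕ) (u : E3) (F : Finset E3) : 0 ≤ dirSum n u F := by
  unfold dirSum
  exact Finset.sum_nonneg fun i _ => Finset.sum_nonneg fun k _ => by positivity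

/-- a non-zero uniaxial virial forces `D₁₂ᵘ > 0` (if every `r⁻¹² cos²` vanishes, so does every `(r⁻¹⁴ − r⁻⁸)⟪Δ,u⟫²`). -/
theorem dirSum_pos_of_virialForm_ne (u : E3) (F : Finset E3) (h : virialForm F u u ≠ 0) : 0 < dirSum 12 u F := by
  by_contra hle
  have h0 : dirSum 12 u F = 0 := le_antisymm (not_lt.mp hle) (dirSum_nonneg 12 u F)
  apply h
  unfold dirSum at h0
  unfold virialForm
  have hterm : ∀ i ∈ (Finset.univ : Finset (Fin F.card)), ∀ k ∈ (Finset.univ : Finset (Fin F.card)).erase i,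
      (dist (enum F i) (enum F k))⁻¹ ^ 12 * (inner ℝ u (enum F k - enum F i) / dist (enum F i) (enum F k)) ^ 2 = 0 := by
    have hnn : ∀ i ∈ (Finset.univ : Finset (Fin F.card)), 0 ≤ ∑ k ∈ (Finset.univ : Finset (Fin F.card)).erase i,
        (dist (enum F i) (enum F k))⁻¹ ^ 12 * (inner ℝ u (enum F k - enum F i) / dist (enum F i) (enum F k)) ^ 2 :=
      fun i _ => Finset.sum_nonneg fun k _ => by positivity
    intro i hi k hk
    have hi0 := (Finset.sum_eq_zero_iff_of_nonneg hnn).mp h0 i hi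
    exact (Finset.sum_eq_zero_iff_of_nonneg fun k _ => by positivity).mp hi0 k hk
  refine Finset.sum_eq_zero fun i hi => Finset.sum_eq_zero fun k hk => ?_
  have ht := hterm i hi k hk
  set d := dist (enum F i) (enum F k)
  set p := inner ℝ u (enum F k - enum F i)
  by_cases hd : d = 0
  · simp [hd]
  · have hd' : 0 < d := lt_of_le_of_ne dist_nonneg (Ne.symm hd)
    have hp : p = 0 := by
      rcases mul_eq_zero.mp ht with h1 | h2
      · exact absurd h1 (by positivity)
      · have := pow_eq_zero_iff (n := 2) (by norm_num) |>.mp h2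
        rcases div_eq_zero_iff.mp this with h3 | h4
        · exact h3
        · exact absurd h4 hd
    simp [hp]

/-- ★ monotone lower bound: `|𝒲(u,u)| ≥ w ≥ 0` and `0 < D₁₂ᵘ ≤ D` give `shearGain u F ≥ min (3 w² / (392 D)) (w / 80)`. -/
theorem le_shearGain (u : E3) (F : Finset E3) {w D : ℝ} (hw₀ : 0 ≤ w) (hw : w ≤ |virialForm F u u|)
    (hD₀ : 0 < dirSum 12 u F) (hD : dirSum 12 u F ≤ D) : min (3 * w ^ 2 / (392 * D)) (w / 80) ≤ shearGain u F := by
  unfold shearGain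
  rw [dirSum_sub_dirSum]
  have hDpos : 0 < D := lt_of_lt_of_le hD₀ hD
  refine min_le_min ?_ (by linarith)
  have h1 : w ^ 2 ≤ (virialForm F u u) ^ 2 := by
    calc w ^ 2 ≤ |virialForm F u u| ^ 2 := pow_le_pow_left₀ hw₀ hw 2
      _ = (virialForm F u u) ^ 2 := sq_abs _
  calc 3 * w ^ 2 / (392 * D) ≤ 3 * (virialForm F u u) ^ 2 / (392 * D) := by
        apply div_le_div_of_nonneg_right _ (by positivity); nlinarith
    _ ≤ 3 * (virialForm F u u) ^ 2 / (392 * dirSum 12 u F) := by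
        apply div_le_div_of_nonneg_left (by positivity) (by positivity); nlinarith

/-- ★ **contradiction with `StressFree`.**  If, in a fixed direction `u` of unit length, cofinally-in-`ℓ` some cube chunk of `Y` has
`|𝒲(F)(u,u)| ≥ c ℓ³` together with `D₁₂ᵘ(F) ≤ C ℓ³`, then `Y` has shear-strained cubes at rate `min (3c²/(392 C)) (c/80)`; hence it is
not stress-free. -/
theorem shearStrainedCubes_of_virial (Y : Set E3) (u : E3) {c C : ℝ} (hc : 0 < c) (hC : 0 < C)
    (h : ∀ ℓ₀ : ℝ, ∃ ℓ : ℝ, ℓ₀ ≤ ℓ ∧ 0 < ℓ ∧ ∃ c₀ : E3, ∃ F : Finset E3,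
      (↑F : Set E3) = Y ∩ {z | ∀ i : Fin 3, c₀ i ≤ z i ∧ z i < c₀ i + ℓ} ∧
        c * ℓ ^ 3 ≤ |virialForm F u u| ∧ dirSum 12 u F ≤ C * ℓ ^ 3) :
    ShearStrainedCubes (min (3 * c ^ 2 / (392 * C)) (c / 80)) u Y := by
  intro ℓ₀
  obtain ⟨ℓ, hℓ₀, hℓ, c₀, F, hF, hW, hD⟩ := h ℓ₀
  refine ⟨ℓ, hℓ₀, c₀, F, hF, ?_⟩
  have hD₀ : 0 < dirSum 12 u F := dirSum_pos_of_virialForm_ne u F fun h0 => by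
    rw [h0, abs_zero] at hW
    exact absurd hW (not_le.mpr (by positivity))
  have key := le_shearGain u F (w := c * ℓ ^ 3) (D := C * ℓ ^ 3) (by positivity) hW hD₀ hD
  have e : min (3 * (c * ℓ ^ 3) ^ 2 / (392 * (C * ℓ ^ 3))) (c * ℓ ^ 3 / 80) = min (3 * c ^ 2 / (392 * C)) (c / 80) * ℓ ^ 3 := by
    have hl3 : 0 < ℓ ^ 3 := by positivity
    rw [min_mul_of_nonneg _ _ hl3.le]
    congr 1
    · field_simp
    · ring
  rw [e] at key
  exact key

/-- a configuration with cube chunks of large virial form along a unit direction (and controlled `D₁₂`) is not `StressFree`. -/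
theorem not_stressFree_of_virial (Y : Set E3) (u : E3) (hu : ‖u‖ = 1) {c C : ℝ} (hc : 0 < c) (hC : 0 < C)
    (h : ∀ ℓ₀ : ℝ, ∃ ℓ : ℝ, ℓ₀ ≤ ℓ ∧ 0 < ℓ ∧ ∃ c₀ : E3, ∃ F : Finset E3,
      (↑F : Set E3) = Y ∩ {z | ∀ i : Fin 3, c₀ i ≤ z i ∧ z i < c₀ i + ℓ} ∧
        c * ℓ ^ 3 ≤ |virialForm F u u| ∧ dirSum 12 u F ≤ C * ℓ ^ 3) :
    ¬ StressFree Y := fun hSF =>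
  hSF u hu _ (lt_min (by positivity) (by positivity)) (shearStrainedCubes_of_virial Y u hc hC h)

end Summit.AtomisticToContinuum.Crystallization.Theorems.ChartedPlanarOrderPlanesVirialForm
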